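import Summits.ResolutionOfSingularities.ResolutionOfSingularities.Theorems.MarkedTransferCampaignW46ThreefoldsGammaFreeGlobalSNCAt
import Literature.AlgebraicGeometry.Resolution.DivisorialPart
import Literature.AlgebraicGeometry.Resolution.DivisorialPartLemmas
import Literature.AlgebraicGeometry.Resolution.PrimeDivisorIdeals
import Literature.AlgebraicGeometry.Resolution.RegularCentreRsopPart
import Literature.AlgebraicGeometry.Resolution.EmbeddedCurvePointBlowups
import Literature.AlgebraicGeometry.Resolution.QuasiExcellentClosedSubschemes
import Literature.AlgebraicGeometry.Resolution.PointBlowupHsFunMono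
import Literature.AlgebraicGeometry.Resolution.ResolutionOfCurves
import Literature.AlgebraicGeometry.Resolution.AlterationsCurves
import Literature.Topology.KrullDimensionDrop
import HarnessLib

/-!
# [OURS · L1 W4.6 rung (ii-2), brick B11b] Finiteness of the non-snc locus of the prime divisors of
# `V(I)` on a regular excellent surface

Route `ResolutionOfSingularities/MarkedTransfer`, campaign W4.6 (`CampaignW46`), rung (ii-2) of the
`GammaFree` global ladder (holder res-D-pv-049 AS res-L1-s46-pv-11, SPLIT-OFFER 2026-08-27T05:57:54Z,
brick (B11b); custody res-plan-2 05:58:37Z; typed predicate `CampaignW46.SNCAt` by res-L1-type-o1,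
p503920).  Everything here is OURS; nothing is a statement of the manuscript under review; AI-written
(weaker than expert review).

STATEMENT (`finite_setOf_not_sncAt_divisorial`). `X` a regular, integral, Noetherian, EXCELLENT scheme
with `topologicalKrullDim X ≤ 2`, `I ≠ 0` an ideal sheaf, `L` the list of the prime divisor ideal
sheaves `𝓘_{cl ζ}` of the codimension-one points `ζ` of `V(I)` (`divisorialPoints`, finitely many).
Then the set of points `y` at which `L` does NOT have simple normal crossings (`¬ SNCAt L y`) is
FINITE and consists of CLOSED points.

PROOF.  For each `ζ` let `C_ζ ↪ X` be the integral curve `cl ζ` with its reduced structure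
(`(primeDivisorIdeal ζ).subscheme`); it is Noetherian, quasi-excellent (closed subscheme of the
excellent `X`) and of dimension `≤ 1`, so every proper closed subset of it is a finite set of closed
points (`Set.finite_and_isClosed_singleton_of_dim_le_one`).  The BAD SET of `ζ` — the points `y` of
`cl ζ` where the branch is singular (`𝒪_{X,y}/𝔭_ζ` not regular, i.e. `y` a singular point of `C_ζ`:
closed proper subset by quasi-excellence) or through which another `ζ' ≠ ζ` of the list passes
(`cl ζ ∩ cl ζ'`, a proper closed subset of `C_ζ` since `ζ' ⤳ ζ` is excluded by the coheights) — is
therefore finite and made of closed points.  OFF the union of the bad sets, `SNCAt L y` holds: if no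
`ζ` specialises to `y`, no member of `L` passes through `y` and any regular system of parameters of
the regular `𝒪_{X,y}` will do; otherwise exactly one `ζ ⤳ y`, its prime `𝔭_ζ = (p)` is principal
(`𝒪_{X,y}` is factorial) with `𝒪_{X,y}/(p)` regular, so `p ∉ 𝔪²` extends to a regular system of
parameters (`exists_span_eq_of_isRegularLocalRing_quotient`, `exists_extend_to_rsop`) whose first
member generates the stalk `(𝓘_{cl ζ})_y = 𝔭_ζ` of the unique member of `L` through `y`.
-/

noncomputable section

set_option linter.dupNamespace false -- mandated namespace of this single-conjunct summit

open CategoryTheory AlgebraicGeometry TopologicalSpace IsLocalRing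

namespace Summit.ResolutionOfSingularities.ResolutionOfSingularities.Theorems

namespace CampaignW46

open Literature.AlgebraicGeometry.Resolution
open Scheme.IdealSheafData

universe u

variable {X : Scheme.{u}}

/-! ## §1 Local criteria for `SNCAt` -/

/-- **No member through `y`**: at a point with regular local ring through which no member of `L`
passes, `SNCAt L y` holds with any regular system of parameters. [folklore] -/
theorem sncAt_of_forall_not_mem_support (L : List X.IdealSheafData) {y : X}
    (hreg : IsRegularLocalRing (X.presheaf.stalk y)) (h : ∀ D ∈ L, y ∉ D.support) : SNCAt L y := by
  classical
  haveI := hreg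
  obtain ⟨s, hs, hspan⟩ := Submodule.FG.exists_span_finset_card_eq_spanFinrank
    (IsLocalRing.maximalIdeal (X.presheaf.stalk y)).fg_of_isNoetherianRing
  let ε := (Finset.equivFinOfCardEq hs).symm
  have hrange : Set.range (fun i => ((ε i : s) : X.presheaf.stalk y)) = s := by
    ext a
    constructor
    · rintro ⟨i, rfl⟩
      exact (ε i).2
    · intro ha
      exact ⟨ε.symm ⟨a, ha⟩, by simp⟩
  have hemp : ∀ D : {D : X.IdealSheafData // D ∈ L ∧ y ∈ D.support}, False :=
    fun D => h D.1 D.2.1 D.2.2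
  refine ⟨hreg, fun i => ((ε i : s) : X.presheaf.stalk y), ?_,
    ⟨fun D => (hemp D).elim, fun D => (hemp D).elim, fun D => (hemp D).elim⟩⟩
  rw [hrange]
  exact hspan

/-- **One principal regular branch through `y`**: if `𝒪_{X,y}` is regular, `0 ≠ p ∈ 𝔪_y` has regular
quotient `𝒪_{X,y}/(p)`, all members of `L` through `y` coincide and have stalk `(p)` at `y`, then
`SNCAt L y` holds — `p ∉ 𝔪²` (regular quotient) is the first member of a regular system of parameters
(`exists_span_eq_of_isRegularLocalRing_quotient`, `exists_extend_to_rsop`).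
[cite: Matsumura1987, Thm. 14.2] -/
theorem sncAt_of_stalkIdeal_eq_span_singleton (L : List X.IdealSheafData) {y : X}
    (hreg : IsRegularLocalRing (X.presheaf.stalk y)) {p : X.presheaf.stalk y}
    (hp : p ∈ maximalIdeal (X.presheaf.stalk y)) (hp0 : p ≠ 0)
    (hquot : IsRegularLocalRing (X.presheaf.stalk y ⧸ Ideal.span {p}))
    (hsub : ∀ D₁ D₂ : {D : X.IdealSheafData // D ∈ L ∧ y ∈ D.support}, D₁ = D₂)
    (hgen : ∀ D : {D : X.IdealSheafData // D ∈ L ∧ y ∈ D.support},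
      stalkIdeal D.1 y = Ideal.span {p}) : SNCAt L y := by
  classical
  haveI := hreg
  haveI := hquot
  have hJ : Ideal.span {p} ≤ maximalIdeal (X.presheaf.stalk y) := by
    rw [Ideal.span_le, Set.singleton_subset_iff]
    exact hp
  obtain ⟨c, f, hfG, hspan, hli⟩ :=
    exists_span_eq_of_isRegularLocalRing_quotient hJ ({p} : Set (X.presheaf.stalk y)) rfl
  have hfp : ∀ i, f i = p := fun i => Set.mem_singleton_iff.mp (hfG i)
  have hf : ∀ i, f i ∈ maximalIdeal (X.presheaf.stalk y) := fun i => by rw [hfp i]; exact hp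
  have hc : 0 < c := by
    rcases Nat.eq_zero_or_pos c with h0 | h0
    · subst h0
      exfalso
      apply hp0
      have hbot : Ideal.span (Set.range f) = ⊥ := by
        rw [Set.range_eq_empty, Ideal.span_empty]
      rw [hbot] at hspan
      exact Ideal.span_singleton_eq_bot.mp hspan.symm
    · exact h0
  have hind := (linearIndependent_toCotangent_iff_forall_mem f hf).mp hli
  obtain ⟨e, yv, hdim, hspan'⟩ := exists_extend_to_rsop f hf hind
  have hz : IsRsopPart f := ⟨hreg, e, yv, hdim, hspan'⟩
  obtain ⟨e', w, hfr, hwspan, hwz⟩ := hz.exists_rsop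
  let σ : Fin (maximalIdeal (X.presheaf.stalk y)).spanFinrank ≃ Fin (c + e') := finCongr hfr
  refine ⟨hreg, w ∘ σ, ?_, ⟨fun _ => σ.symm (Fin.castAdd e' ⟨0, hc⟩), ?_, ?_⟩⟩
  · rw [σ.surjective.range_comp]
    exact hwspan
  · intro D₁ D₂ _
    exact hsub D₁ D₂
  · intro D
    rw [hgen D, Function.comp_apply, Equiv.apply_symm_apply, hwz, hfp]

/-! ## §2 The branch curve `C_ζ = cl ζ` (reduced) and its proper closed subsets -/

section Branch

variable [IsIntegral X] [AlgebraicGeometry.IsNoetherian X]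

/-- In `WithBot ℕ∞`: `d < 2 → d ≤ 1`. [folklore] -/
private theorem withBotENat_le_one_of_lt_two {d : WithBot ℕ∞} (h : d < (2 : ℕ)) : d ≤ 1 := by
  induction d using WithBot.recBotCoe with
  | bot => exact bot_le
  | coe a =>
    induction a using ENat.recTopCoe with
    | top => exact absurd h (by simp)
    | coe n =>
      have h' : ((n : ℕ∞) : WithBot ℕ∞) < ((2 : ℕ∞) : WithBot ℕ∞) := by simpa using h
      have h2 : (n : ℕ∞) < 2 := WithBot.coe_lt_coe.mp h'
      have h3 : n < 2 := by exact_mod_cast h2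
      exact_mod_cast (show n ≤ 1 by omega)

omit [AlgebraicGeometry.IsNoetherian X] in
/-- A point of codimension one is not the generic point, so its closure is a proper closed subset.
[folklore] -/
theorem closure_singleton_ne_univ_of_coheight_eq_one {ζ : X} (hζ : Order.coheight ζ = 1) :
    closure ({ζ} : Set X) ≠ Set.univ := by
  intro h
  have hgen : ζ ⤳ genericPoint X := by
    rw [specializes_iff_mem_closure, h]; exact Set.mem_univ _
  have hmax : Order.coheight (genericPoint X) = 0 := by
    rw [Order.coheight_eq_zero]
    intro b _
    exact Scheme.le_iff_specializes.mpr (genericPoint_specializes b)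
  have := eq_of_specializes_of_coheight_le hgen (by rw [hmax]; exact ENat.coe_ne_top 0)
    (by rw [hmax]; exact bot_le)
  rw [this, hmax] at hζ
  exact zero_ne_one hζ

/-- **Proper closed subsets of a branch curve are finite sets of closed points.** For `X` integral
Noetherian quasi-excellent with `topologicalKrullDim X ≤ 2` and `ζ` of codimension one, let
`C := V(𝓘_{cl ζ})` (the reduced curve `cl ζ`, `(primeDivisorIdeal ζ).subscheme`) with its closed
immersion `ι : C → X`; then the image of every closed `W ⊊ C` is finite and consists of closed points
of `X` (`C` is an integral Noetherian quasi-excellent scheme of dimension `≤ 1`,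
`Set.finite_and_isClosed_singleton_of_dim_le_one`). [folklore] -/
theorem finite_image_subschemeι_of_isClosed (hdim : topologicalKrullDim X ≤ 2) {ζ : X}
    (hζ : Order.coheight ζ = 1) {W : Set (primeDivisorIdeal ζ).subscheme} (hW : IsClosed W)
    (hWne : W ≠ Set.univ) :
    ((primeDivisorIdeal ζ).subschemeι.base '' W).Finite ∧
      ∀ y ∈ (primeDivisorIdeal ζ).subschemeι.base '' W, IsClosed ({y} : Set X) := by
  set C := (primeDivisorIdeal ζ).subscheme
  set ι := (primeDivisorIdeal ζ).subschemeι
  haveI : IsIntegral C :=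
    isIntegral_subscheme_vanishingIdeal ⟨closure {ζ}, isClosed_closure⟩
      isIrreducible_singleton.closure
  haveI : IsNoetherian C := isNoetherian_of_isClosedImmersion ι
  have hemb : Topology.IsClosedEmbedding ι.base := ι.isClosedEmbedding
  have hrange : Set.range ι.base = closure {ζ} := by
    have h1 : Set.range ι.base = ((primeDivisorIdeal ζ).support : Set X) := range_subschemeι _
    rw [h1, coe_support_primeDivisorIdeal]
  -- `dim C ≤ 1`
  have hdimC : topologicalKrullDim C ≤ 1 := by
    have hmem : ∀ c : C, ι.base c ∈ closure ({ζ} : Set X) := fun c => hrange ▸ ⟨c, rfl⟩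
    have hle : topologicalKrullDim C ≤ topologicalKrullDim (closure ({ζ} : Set X)) :=
      (hemb.isInducing.codRestrict hmem).topologicalKrullDim_le
    have hlt : topologicalKrullDim (closure ({ζ} : Set X)) < ((2 : ℕ) : WithBot ℕ∞) :=
      Literature.Topology.topologicalKrullDim_lt_of_isClosed_ssubset isClosed_closure
        (closure_singleton_ne_univ_of_coheight_eq_one hζ) 2
        (lt_of_le_of_lt hdim (by exact_mod_cast WithBot.coe_lt_coe.mpr (by decide)))
    exact withBotENat_le_one_of_lt_two (lt_of_le_of_lt hle hlt)
  obtain ⟨hfin, hcl⟩ := Set.finite_and_isClosed_singleton_of_dim_le_one hdimC hW hWne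
  refine ⟨hfin.image _, ?_⟩
  rintro _ ⟨c, hc, rfl⟩
  rw [← Set.image_singleton]
  exact hemb.isClosedMap _ (hcl c hc)

omit [IsIntegral X] [AlgebraicGeometry.IsNoetherian X] in
/-- The generic point of the branch curve `C_ζ` maps to `ζ`. [folklore] -/
theorem subschemeι_genericPoint_eq {ζ : X} [IsIntegral (primeDivisorIdeal ζ).subscheme] :
    (primeDivisorIdeal ζ).subschemeι.base (genericPoint (primeDivisorIdeal ζ).subscheme) = ζ := by
  set C := (primeDivisorIdeal ζ).subscheme
  set ι := (primeDivisorIdeal ζ).subschemeι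
  have hrange : Set.range ι.base = closure {ζ} := by
    have h1 : Set.range ι.base = ((primeDivisorIdeal ζ).support : Set X) := range_subschemeι _
    rw [h1, coe_support_primeDivisorIdeal]
  -- `ζ = ι c₀` and `genericPoint C ⤳ c₀`, so `ι (genericPoint C) ⤳ ζ`; conversely `ζ ⤳ ι (…)`
  obtain ⟨c₀, hc₀⟩ : ζ ∈ Set.range ι.base := by rw [hrange]; exact subset_closure rfl
  have h1 : ι.base (genericPoint C) ⤳ ι.base c₀ :=
    (genericPoint_specializes c₀).map ι.base.hom.continuous
  rw [hc₀] at h1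
  have h2 : ζ ⤳ ι.base (genericPoint C) := by
    rw [specializes_iff_mem_closure, ← hrange]; exact ⟨_, rfl⟩
  exact (h1.antisymm h2).eq

/-- **The bad set of a branch is finite.** For `X` integral, Noetherian, quasi-excellent, of
dimension `≤ 2`, `ζ` of codimension one and `S` a finite set of points of codimension one: the
points `y` of `cl ζ` at which the branch is singular (`𝒪_{X,y}/(𝓘_{cl ζ})_y` not regular) or through
which some `ζ' ∈ S`, `ζ' ≠ ζ`, passes form a finite set of closed points. [folklore] -/
theorem finite_badSet_branch (hXe : Scheme.IsQuasiExcellent X) (hdim : topologicalKrullDim X ≤ 2)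
    {ζ : X} (hζ : Order.coheight ζ = 1) {S : Set X} (hS : S.Finite)
    (hS1 : ∀ ζ' ∈ S, Order.coheight ζ' = 1) :
    {y : X | ζ ⤳ y ∧ (¬ IsRegularLocalRing (X.presheaf.stalk y ⧸ stalkIdeal (primeDivisorIdeal ζ) y) ∨
      ∃ ζ' ∈ S, ζ' ≠ ζ ∧ ζ' ⤳ y)}.Finite ∧
    ∀ y : X, ζ ⤳ y → (¬ IsRegularLocalRing (X.presheaf.stalk y ⧸ stalkIdeal (primeDivisorIdeal ζ) y) ∨
      ∃ ζ' ∈ S, ζ' ≠ ζ ∧ ζ' ⤳ y) → IsClosed ({y} : Set X) := by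
  set C := (primeDivisorIdeal ζ).subscheme
  set ι := (primeDivisorIdeal ζ).subschemeι
  haveI : IsIntegral C :=
    isIntegral_subscheme_vanishingIdeal ⟨closure {ζ}, isClosed_closure⟩
      isIrreducible_singleton.closure
  haveI : IsNoetherian C := isNoetherian_of_isClosedImmersion ι
  have hCqe : Scheme.IsQuasiExcellent C := Scheme.IsQuasiExcellent.of_isClosedImmersion ι hXe
  have hrange : Set.range ι.base = closure {ζ} := by
    have h1 : Set.range ι.base = ((primeDivisorIdeal ζ).support : Set X) := range_subschemeι _
    rw [h1, coe_support_primeDivisorIdeal]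
  have hgen : ι.base (genericPoint C) = ζ := subschemeι_genericPoint_eq
  -- the closed subset `W = Sing C ∪ ⋃_{ζ' ≠ ζ} ι⁻¹ cl ζ'` of `C`
  set W : Set C := (Scheme.regularLocus C)ᶜ ∪ ⋃ ζ' ∈ S \ {ζ}, ι.base ⁻¹' closure {ζ'} with hWdef
  have hWcl : IsClosed W := by
    refine (Scheme.isOpen_regularLocus_of_isQuasiExcellent hCqe).isClosed_compl.union ?_
    exact (hS.subset Set.sdiff_subset).isClosed_biUnion fun ζ' _ => isClosed_closure.preimage ι.base.hom.continuous
  have hWne : W ≠ Set.univ := by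
    intro h
    have hg : genericPoint C ∈ W := h ▸ Set.mem_univ _
    rcases hg with hg | hg
    · exact hg (genericPoint_mem_regularLocus C)
    · obtain ⟨ζ', hζ', hmem⟩ := Set.mem_iUnion₂.mp hg
      rw [Set.mem_preimage, hgen, ← specializes_iff_mem_closure] at hmem
      exact not_specializes_of_coheight_eq_one (hS1 ζ' hζ'.1) hζ hζ'.2 hmem
  obtain ⟨hfin, hcl⟩ := finite_image_subschemeι_of_isClosed hdim hζ hWcl hWne
  -- the bad set is the image of `W`
  have hsub : ∀ y : X, ζ ⤳ y →
      (¬ IsRegularLocalRing (X.presheaf.stalk y ⧸ stalkIdeal (primeDivisorIdeal ζ) y) ∨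
        ∃ ζ' ∈ S, ζ' ≠ ζ ∧ ζ' ⤳ y) → y ∈ ι.base '' W := by
    intro y hy hbad
    obtain ⟨c, rfl⟩ : y ∈ Set.range ι.base := by rwa [hrange, ← specializes_iff_mem_closure]
    refine ⟨c, ?_, rfl⟩
    rcases hbad with hsing | ⟨ζ', hζ'S, hne, hζ'y⟩
    · left
      intro hreg
      exact hsing ((isRegularLocalRing_stalk_subscheme_iff (primeDivisorIdeal ζ) c).mp hreg)
    · right
      exact Set.mem_iUnion₂.mpr ⟨ζ', ⟨hζ'S, hne⟩, specializes_iff_mem_closure.mp hζ'y⟩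
  exact ⟨hfin.subset fun y hy => hsub y hy.1 hy.2, fun y hy hbad => hcl y (hsub y hy hbad)⟩

end Branch

/-! ## §3 The non-snc locus of a finite family of prime divisors -/

section Main

variable [IsIntegral X] [AlgebraicGeometry.IsNoetherian X]

/-- **[OURS · W4.6 rung (ii-2), brick B11b] The non-snc locus of finitely many prime divisors on a
regular quasi-excellent surface is a finite set of closed points.** `X` regular, integral, Noetherian,
quasi-excellent, `topologicalKrullDim X ≤ 2`; `S` a finite set of points of codimension one and `L`
the list of their prime divisor ideal sheaves `𝓘_{cl ζ}`: the points `y` with `¬ SNCAt L y` form a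
finite set of closed points (they lie in the union of the bad sets of the branches,
`finite_badSet_branch`; off it `SNCAt` holds by `sncAt_of_forall_not_mem_support` /
`sncAt_of_stalkIdeal_eq_span_singleton`). NOT a statement of the manuscript.
[cite: Kollar2007, (3.111) Step 3] -/
theorem finite_setOf_not_sncAt_primeDivisorIdeal (hX : Scheme.IsRegular X)
    (hXe : Scheme.IsQuasiExcellent X) (hdim : topologicalKrullDim X ≤ 2) {S : Set X} (hS : S.Finite)
    (hS1 : ∀ ζ ∈ S, Order.coheight ζ = 1) :
    {y : X | ¬ SNCAt (hS.toFinset.toList.map primeDivisorIdeal) y}.Finite ∧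
      ∀ y : X, ¬ SNCAt (hS.toFinset.toList.map primeDivisorIdeal) y → IsClosed ({y} : Set X) := by
  classical
  set L := hS.toFinset.toList.map primeDivisorIdeal with hL
  have hmemL : ∀ D, D ∈ L ↔ ∃ ζ ∈ S, primeDivisorIdeal ζ = D := by
    intro D
    simp only [hL, List.mem_map, Finset.mem_toList, Set.Finite.mem_toFinset]
  -- the bad set: union over `ζ ∈ S` of the bad sets of the branches
  set B : Set X := ⋃ ζ ∈ S, {y : X | ζ ⤳ y ∧
      (¬ IsRegularLocalRing (X.presheaf.stalk y ⧸ stalkIdeal (primeDivisorIdeal ζ) y) ∨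
        ∃ ζ' ∈ S, ζ' ≠ ζ ∧ ζ' ⤳ y)} with hB
  have hBfin : B.Finite :=
    hS.biUnion fun ζ hζ => (finite_badSet_branch hXe hdim (hS1 ζ hζ) hS hS1).1
  have hBcl : ∀ y ∈ B, IsClosed ({y} : Set X) := by
    intro y hy
    obtain ⟨ζ, hζ, hy'⟩ := Set.mem_iUnion₂.mp hy
    exact (finite_badSet_branch hXe hdim (hS1 ζ hζ) hS hS1).2 y hy'.1 hy'.2
  -- off the bad set, `SNCAt L y`
  have hgood : ∀ y : X, y ∉ B → SNCAt L y := by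
    intro y hyB
    by_cases hex : ∃ ζ ∈ S, ζ ⤳ y
    · obtain ⟨ζ, hζS, hζy⟩ := hex
      have huniq : ∀ ζ' ∈ S, ζ' ⤳ y → ζ' = ζ := by
        intro ζ' hζ'S hζ'y
        by_contra hne
        exact hyB (Set.mem_iUnion₂.mpr ⟨ζ, hζS, hζy, Or.inr ⟨ζ', hζ'S, hne, hζ'y⟩⟩)
      have hbr : IsRegularLocalRing (X.presheaf.stalk y ⧸ stalkIdeal (primeDivisorIdeal ζ) y) := by
        by_contra h
        exact hyB (Set.mem_iUnion₂.mpr ⟨ζ, hζS, hζy, Or.inl h⟩)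
      haveI := hX y
      obtain ⟨p, hp, hpeq⟩ := exists_stalkIdeal_primeDivisorIdeal_eq_span
        (Scheme.IsRegular.uniqueFactorizationMonoid_stalk hX) hζy (hS1 ζ hζS)
      rw [hpeq] at hbr
      refine sncAt_of_stalkIdeal_eq_span_singleton L (hX y) ?_ hp.ne_zero hbr ?_ ?_
      · exact (IsLocalRing.mem_maximalIdeal _).mpr hp.not_unit
      · rintro ⟨D₁, hD₁, hy₁⟩ ⟨D₂, hD₂, hy₂⟩
        obtain ⟨ζ₁, hζ₁, rfl⟩ := (hmemL D₁).mp hD₁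
        obtain ⟨ζ₂, hζ₂, rfl⟩ := (hmemL D₂).mp hD₂
        have e₁ := huniq ζ₁ hζ₁ ((mem_support_primeDivisorIdeal_iff ζ₁ y).mp hy₁)
        have e₂ := huniq ζ₂ hζ₂ ((mem_support_primeDivisorIdeal_iff ζ₂ y).mp hy₂)
        apply Subtype.ext
        change primeDivisorIdeal ζ₁ = primeDivisorIdeal ζ₂
        rw [e₁, e₂]
      · rintro ⟨D, hD, hyD⟩
        obtain ⟨ζ₁, hζ₁, rfl⟩ := (hmemL D).mp hD
        have e₁ := huniq ζ₁ hζ₁ ((mem_support_primeDivisorIdeal_iff ζ₁ y).mp hyD)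
        change stalkIdeal (primeDivisorIdeal ζ₁) y = Ideal.span {p}
        rw [e₁, hpeq]
    · refine sncAt_of_forall_not_mem_support L (hX y) fun D hD hyD => ?_
      obtain ⟨ζ, hζ, rfl⟩ := (hmemL D).mp hD
      exact hex ⟨ζ, hζ, (mem_support_primeDivisorIdeal_iff ζ y).mp hyD⟩
  refine ⟨hBfin.subset fun y hy => ?_, fun y hy => hBcl y ?_⟩
  · by_contra h
    exact hy (hgood y h)
  · by_contra h
    exact hy (hgood y h)

/-- **[OURS · W4.6 rung (ii-2), brick B11b — the holder's statement]** (res-D-pv-049 AS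
res-L1-s46-pv-11, SPLIT-OFFER 2026-08-27T05:57:54Z): for `X` regular, integral, Noetherian,
EXCELLENT with `topologicalKrullDim X ≤ 2` and `I ≠ 0`, the list `L` of the prime divisor ideal
sheaves of the codimension-one points of `V(I)` (`divisorialPoints`, the boundary list of
`orderReducible_of_hasSNC_nhds`) fails to have simple normal crossings (`SNCAt`) only at a finite set
of closed points — the input of the (ii-2) end-game: after finitely many point blow-ups the boundary
is snc near `Sing(I, m)`. NOT a statement of the manuscript. [cite: Kollar2007, (3.111) Step 3] -/
theorem finite_setOf_not_sncAt_divisorial (hX : Scheme.IsRegular X) (hXe : Scheme.IsExcellent X)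
    (hdim : topologicalKrullDim X ≤ 2) {I : X.IdealSheafData} (hI : I ≠ ⊥) :
    {y : X | ¬ SNCAt (((finite_divisorialPoints hI).toFinset.toList).map primeDivisorIdeal) y}.Finite ∧
      ∀ y : X, ¬ SNCAt (((finite_divisorialPoints hI).toFinset.toList).map primeDivisorIdeal) y →
        IsClosed ({y} : Set X) :=
  finite_setOf_not_sncAt_primeDivisorIdeal hX hXe.isQuasiExcellent hdim (finite_divisorialPoints hI)
    fun ζ hζ => ((mem_divisorialPoints_iff I ζ).mp hζ).2

end Main

end CampaignW46

end Summit.ResolutionOfSingularities.ResolutionOfSingularities.Theorems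

end
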